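import Literature.NumberTheory.Automorphic.AutomorphicQuotientKernelConvolution
import Literature.NumberTheory.Automorphic.AdelicGroupDataQuotientSubgroupProduct
import HarnessLib

/-!
# The kernel of `R(f)` as an integral over `A_G` of a sum over `G(K)`:
`K_f(x̃, ỹH) = κ ∫_{A_G} Σ_{γ ∈ G(K)} f(x̃ γ⁻¹ a⁻¹ ỹ⁻¹) da` and, on the diagonal,
`K_Φ(x, x) = κ Σ_{γ ∈ G(K)} ∫_{A_G} Φ(a⁻¹ x̃ γ x̃⁻¹) da`
(Gelbart, *Automorphic forms on adele groups* (1975), (9.7), (9.20):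
`K(x, y) = Σ_{γ ∈ G_ℚ} f(x⁻¹ γ y)`; (9.12), Remark 9.23: the sum over `G_ℚ` on the diagonal;
Bump (1997), Prop. 2.3.1: `∫_{Γ\G/Z⁺} ∫_{Z⁺} Σ_γ f(h) φ(g⁻¹ γ h u) du dh`)

Topic `NumberTheory/Automorphic`; theorems only (no definition, no named fact, no instance
visible to importers).

Fourth layer of the inline (D-0026) decomposition of the named fact
`Literature.NumberTheory.Automorphic.strong_multiplicity_one_quaternionUnits` (Gelbart (1975),
Thm. 10.5 (ii), proved in the source by the simple trace formula (10.14) = Remark 9.23 on the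
compact quotient of `D^×`). The first layers realised `R(f)` as the integral operator with kernel
`c⁻¹ K_f`, `K_f(x̃, ỹH) = ∫_H f(x̃ h⁻¹ ỹ⁻¹) dρ(h)` for the Haar measure `ρ` of the closed subgroup
`H = A_G · G(K)` (`AutomorphicQuotientKernel`), and proved
`Σ_i ‖R(f) e_i‖² = c⁻¹ ∫_X K_{f ⋆ f^*}(x, x) dμ(x)` (`AutomorphicQuotientKernelConvolution`);
`AdelicGroupDataQuotientSubgroupProduct` proved `H ≅ A_G × G(K)` and
`∫_H F dρ = κ ∫_{A_G} Σ_{γ ∈ G(K)} F(a γ) dα` for `F ≥ 0`. Here the two are combined, for an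
adelic group datum `𝒢` with a continuous central retraction `θ`, discrete countable `G(K)`, a
Haar measure `ρ` on `H` and a Haar measure `α` on `A_G`:

* `AdelicGroupData.isHaarMeasure_map_mul_prod_count`,
  `AdelicGroupData.exists_eq_smul_map_mul_prod_count` — the pushforward of `α ⊗ (counting)` under
  `(a, γ) ↦ a γ` is a Haar measure on `H`, and **`ρ = κ • ((a, γ) ↦ a γ)_* (α ⊗ counting)`** for
  some `κ > 0` (the measure-level form of the product decomposition; Mathlib
  `isMulLeftInvariant_eq_smul`);
* `AdelicGroupData.integral_quotientSubgroup_eq_smul_integral_tsum`,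
  `AdelicGroupData.integral_quotientSubgroup_eq_smul_tsum_integral` — **Bochner versions**: for a
  Banach-valued `F` on `H` with `(a, γ) ↦ F(a γ)` integrable for `α ⊗ counting`,
  `∫_H F dρ = κ • ∫_{A_G} Σ_γ F(a γ) dα = κ • Σ_γ ∫_{A_G} F(a γ) dα`;
* `AdelicGroupData.integrable_comp_mul_of_continuous` — the hypothesis holds for `F` continuous
  with compact support on `H`, in particular for `h ↦ f(x̃ h⁻¹ ỹ⁻¹)`, `f ∈ C_c(G(𝔸_K))`;
* `AdelicGroupData.cosetKernel_mk_eq_smul_integral_tsum` — **the kernel as `∫_{A_G} Σ_γ`**: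
  `K_f(x̃, ỹH) = κ • ∫_{A_G} Σ_{γ ∈ G(K)} f(x̃ γ⁻¹ a⁻¹ ỹ⁻¹) dα(a)`
  (Gelbart (9.20): `K(x, y) = Σ_{γ ∈ G_ℚ} f(x⁻¹ γ y)`, with the integral over `Z_∞⁺` made
  explicit as in Bump Prop. 2.3.1);
* `AdelicGroupData.quotientKernel_mk_mk_eq_smul_tsum_integral` — **on the diagonal**,
  `K_Φ(x̃H, x̃H) = κ • Σ_{γ ∈ G(K)} ∫_{A_G} Φ(a⁻¹ · x̃ γ x̃⁻¹) dα(a)` (reindex `γ ↦ γ⁻¹`, `A_G` is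
  central): the sum over the rational points that the geometric side of the trace formula
  rearranges by conjugacy classes (Gelbart (9.12)–(9.13), Remark 9.23 — the next layer).

## Design notes

* No definition is introduced: the constant `κ` is carried as the hypothesis
  `hκ : ρ = κ • Measure.map (…) (α.prod count)` produced once by
  `exists_eq_smul_map_mul_prod_count`, so that the identities are plain equalities.
* Measurable structures: `[MeasurableSpace 𝒢.Adelic] [BorelSpace 𝒢.Adelic]` as in the previous
  layers; `A_G`, `G(K)`, `H` carry the subtype structures.

## References

* S. Gelbart, *Automorphic forms on adele groups*, Ann. of Math. Studies 83 (1975), §9 (9.7),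
  (9.12), (9.20), Remark 9.23 [Gelbart1975].
* D. Bump, *Automorphic Forms and Representations* (1997), Prop. 2.3.1 (proof) [Bump1997].
* A. Weil, *Basic Number Theory* (1967), Ch. IV §4 [WeilBNT1967].
-/

noncomputable section

open MeasureTheory Measure Set Filter Topology CompactlySupported
open Literature.MeasureTheory.Group
open scoped ENNReal NNReal Pointwise

namespace Literature.NumberTheory.Automorphic

-- the coset space carries the Borel σ-algebra supplied by the user, not the quotient σ-algebra
attribute [-instance] Quotient.instMeasurableSpace QuotientGroup.measurableSpace

namespace AdelicGroupData

universe u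

variable {K : Type} [Field K] [NumberField K] (𝒢 : AdelicGroupData.{u} K)

attribute [local instance] measurableSpaceQuotientForm borelSpaceQuotientForm

/-- The multiplication map `(a, γ) ↦ a γ : A_G × G(K) → H = A_G · G(K)`. [folklore] -/
theorem mulMap_mem (p : 𝒢.center' × 𝒢.arithmeticSubgroup) :
    (p.1 : 𝒢.Adelic) * p.2 ∈ 𝒢.quotientSubgroup :=
  mul_mem (𝒢.center'_le_quotientSubgroup p.1.2) (𝒢.arithmeticSubgroup_le_quotientSubgroup p.2.2)

section Product

variable [LocallyCompactSpace 𝒢.Adelic] [SecondCountableTopology 𝒢.Adelic] [T2Space 𝒢.Adelic]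
  [MeasurableSpace 𝒢.Adelic] [BorelSpace 𝒢.Adelic]
  (hdisc : 𝒢.IsDiscreteRational)
  (θ : 𝒢.Adelic →* 𝒢.Adelic) (hθc : Continuous θ) (hθA : ∀ g, θ g ∈ 𝒢.center')
  (hθa : ∀ a ∈ 𝒢.center', θ a = a) (hθγ : ∀ γ ∈ 𝒢.arithmeticSubgroup, θ γ = 1)
  (α : Measure 𝒢.center')

include hdisc hθc hθA hθa hθγ in
omit [LocallyCompactSpace 𝒢.Adelic] in
/-- **The pushforward of `α ⊗ (counting measure)` under `(a, γ) ↦ a γ` is a Haar measure on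
`H = A_G · G(K)`** (it is the image of the product Haar measure under the isomorphism of
topological groups `A_G × G(K) ≃ H` of `quotientSubgroupEquivOfRetraction`). [folklore] -/
theorem isHaarMeasure_map_mul_prod_count [Countable 𝒢.arithmeticSubgroup] [α.IsHaarMeasure]
    [SFinite α] :
    (Measure.map (fun p : 𝒢.center' × 𝒢.arithmeticSubgroup =>
      (⟨(p.1 : 𝒢.Adelic) * p.2, mulMap_mem 𝒢 p⟩ : 𝒢.quotientSubgroup))
      (α.prod count)).IsHaarMeasure := by
  haveI : DiscreteTopology 𝒢.arithmeticSubgroup := hdisc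
  haveI : SecondCountableTopology 𝒢.center' := TopologicalSpace.Subtype.secondCountableTopology _
  haveI : SecondCountableTopology 𝒢.arithmeticSubgroup :=
    TopologicalSpace.Subtype.secondCountableTopology _
  haveI : BorelSpace 𝒢.arithmeticSubgroup := Subtype.borelSpace _
  haveI : MeasurableSingletonClass 𝒢.arithmeticSubgroup := inferInstance
  haveI : (count : Measure 𝒢.arithmeticSubgroup).IsHaarMeasure := isHaarMeasure_count_of_discrete
  haveI : BorelSpace (𝒢.center' × 𝒢.arithmeticSubgroup) := Prod.borelSpace
  exact ContinuousMulEquiv.isHaarMeasure_map (α.prod count)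
    (quotientSubgroupEquivOfRetraction 𝒢 θ hθA hθa hθγ hθc).symm

include hdisc hθc hθA hθa hθγ in
/-- **`ρ = κ • ((a, γ) ↦ a γ)_* (α ⊗ counting)`** for every Haar measure `ρ` on `H = A_G · G(K)` and
Haar measure `α` on `A_G`, with `κ > 0` (uniqueness of Haar measure on the second countable locally
compact group `H`, Mathlib `isMulLeftInvariant_eq_smul`; the measure-level form of
`exists_lintegral_quotientSubgroup_eq_mul_lintegral_tsum`).
[cite: WeilBNT1967, Ch. IV §4 Cor. 2 of Thm. 5] -/
theorem exists_eq_smul_map_mul_prod_count [Countable 𝒢.arithmeticSubgroup] [α.IsHaarMeasure]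
    [SFinite α] (ρ : Measure 𝒢.quotientSubgroup) [ρ.IsHaarMeasure] :
    ∃ κ : ℝ≥0, 0 < κ ∧ ρ = κ • Measure.map (fun p : 𝒢.center' × 𝒢.arithmeticSubgroup =>
      (⟨(p.1 : 𝒢.Adelic) * p.2, mulMap_mem 𝒢 p⟩ : 𝒢.quotientSubgroup)) (α.prod count) := by
  haveI := isHaarMeasure_map_mul_prod_count 𝒢 hdisc θ hθc hθA hθa hθγ α
  haveI : LocallyCompactSpace 𝒢.quotientSubgroup :=
    (isClosed_quotientSubgroup_of_centralRetraction 𝒢 hdisc θ hθc hθA hθa hθγ)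
      |>.isClosedEmbedding_subtypeVal.locallyCompactSpace
  haveI : SecondCountableTopology 𝒢.quotientSubgroup :=
    TopologicalSpace.Subtype.secondCountableTopology _
  set π := Measure.map (fun p : 𝒢.center' × 𝒢.arithmeticSubgroup =>
      (⟨(p.1 : 𝒢.Adelic) * p.2, mulMap_mem 𝒢 p⟩ : 𝒢.quotientSubgroup)) (α.prod count) with hπ
  exact ⟨haarScalarFactor ρ π, haarScalarFactor_pos_of_isHaarMeasure ρ π,
    isMulLeftInvariant_eq_smul ρ π⟩

include hθc hθA hθa hθγ in
omit [LocallyCompactSpace 𝒢.Adelic] [T2Space 𝒢.Adelic] in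
/-- The multiplication map `A_G × G(K) → H` is a measurable embedding (a homeomorphism onto `H`,
given the central retraction). [folklore] -/
theorem measurableEmbedding_mulMap :
    MeasurableEmbedding fun p : 𝒢.center' × 𝒢.arithmeticSubgroup =>
      (⟨(p.1 : 𝒢.Adelic) * p.2, mulMap_mem 𝒢 p⟩ : 𝒢.quotientSubgroup) := by
  haveI : SecondCountableTopology 𝒢.center' := TopologicalSpace.Subtype.secondCountableTopology _
  haveI : SecondCountableTopology 𝒢.arithmeticSubgroup :=
    TopologicalSpace.Subtype.secondCountableTopology _
  haveI : BorelSpace 𝒢.arithmeticSubgroup := Subtype.borelSpace _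
  haveI : BorelSpace (𝒢.center' × 𝒢.arithmeticSubgroup) := Prod.borelSpace
  exact (quotientSubgroupEquivOfRetraction 𝒢 θ hθA hθa hθγ
    hθc).symm.toHomeomorph.measurableEmbedding

variable {E : Type*} [NormedAddCommGroup E]

include hθc hθA hθa hθγ in
omit [LocallyCompactSpace 𝒢.Adelic] in
/-- **`∫_H F dρ = κ • ∫_{A_G} Σ_{γ ∈ G(K)} F(a γ) dα(a)`** (Bochner version of the product
decomposition): for `ρ = κ • ((a, γ) ↦ a γ)_* (α ⊗ counting)` and a Banach-valued `F` on `H` such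
that `(a, γ) ↦ F(a γ)` is integrable for `α ⊗ counting`. (Mathlib `integral_map`, `integral_prod`,
`integral_countable` for the counting measure.) [folklore] -/
theorem integral_quotientSubgroup_eq_smul_integral_tsum [NormedSpace ℝ E] [CompleteSpace E]
    [Countable 𝒢.arithmeticSubgroup] [SFinite α] {ρ : Measure 𝒢.quotientSubgroup} {κ : ℝ≥0}
    (hκ : ρ = κ • Measure.map (fun p : 𝒢.center' × 𝒢.arithmeticSubgroup =>
      (⟨(p.1 : 𝒢.Adelic) * p.2, mulMap_mem 𝒢 p⟩ : 𝒢.quotientSubgroup)) (α.prod count))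
    {F : 𝒢.quotientSubgroup → E}
    (hF : Integrable (fun p : 𝒢.center' × 𝒢.arithmeticSubgroup =>
      F ⟨(p.1 : 𝒢.Adelic) * p.2, mulMap_mem 𝒢 p⟩) (α.prod count)) :
    ∫ h, F h ∂ρ = κ • ∫ a, ∑' γ : 𝒢.arithmeticSubgroup,
      F ⟨(a : 𝒢.Adelic) * γ, mulMap_mem 𝒢 (a, γ)⟩ ∂α := by
  rw [hκ, integral_smul_nnreal_measure,
    (measurableEmbedding_mulMap 𝒢 θ hθc hθA hθa hθγ).integral_map, integral_prod _ hF]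
  congr 1
  refine integral_congr_ae ?_
  filter_upwards [hF.prod_right_ae] with a ha
  rw [integral_countable ha]
  refine tsum_congr fun γ => ?_
  rw [measureReal_def, count_singleton, ENNReal.toReal_one, one_smul]

include hθc hθA hθa hθγ in
omit [LocallyCompactSpace 𝒢.Adelic] in
/-- **`∫_H F dρ = κ • Σ_{γ ∈ G(K)} ∫_{A_G} F(a γ) dα(a)`** (the same with sum and integral
exchanged, Fubini for `α ⊗ counting`). [folklore] -/
theorem integral_quotientSubgroup_eq_smul_tsum_integral [NormedSpace ℝ E] [CompleteSpace E]
    [Countable 𝒢.arithmeticSubgroup] [SFinite α] {ρ : Measure 𝒢.quotientSubgroup} {κ : ℝ≥0}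
    (hκ : ρ = κ • Measure.map (fun p : 𝒢.center' × 𝒢.arithmeticSubgroup =>
      (⟨(p.1 : 𝒢.Adelic) * p.2, mulMap_mem 𝒢 p⟩ : 𝒢.quotientSubgroup)) (α.prod count))
    {F : 𝒢.quotientSubgroup → E}
    (hF : Integrable (fun p : 𝒢.center' × 𝒢.arithmeticSubgroup =>
      F ⟨(p.1 : 𝒢.Adelic) * p.2, mulMap_mem 𝒢 p⟩) (α.prod count)) :
    ∫ h, F h ∂ρ = κ • ∑' γ : 𝒢.arithmeticSubgroup, ∫ a,
      F ⟨(a : 𝒢.Adelic) * γ, mulMap_mem 𝒢 (a, γ)⟩ ∂α := by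
  rw [hκ, integral_smul_nnreal_measure,
    (measurableEmbedding_mulMap 𝒢 θ hθc hθA hθa hθγ).integral_map, integral_prod_symm _ hF,
    integral_countable hF.integral_prod_right]
  congr 1
  refine tsum_congr fun γ => ?_
  rw [measureReal_def, count_singleton, ENNReal.toReal_one, one_smul]

include hdisc hθc hθA hθa hθγ in
omit [LocallyCompactSpace 𝒢.Adelic] in
/-- **A continuous compactly supported function on `H` is integrable on `A_G × G(K)`**: for `F`
continuous with compact support on `H`, `(a, γ) ↦ F(a γ)` is integrable for `α ⊗ counting` (it is
continuous with compact support on `A_G × G(K) ≅ H`, and `α ⊗ counting` is finite on compact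
sets). [folklore] -/
theorem integrable_comp_mul_of_continuous [Countable 𝒢.arithmeticSubgroup] [α.IsHaarMeasure]
    [SFinite α] {F : 𝒢.quotientSubgroup → E} (hFc : Continuous F) (hFs : HasCompactSupport F) :
    Integrable (fun p : 𝒢.center' × 𝒢.arithmeticSubgroup =>
      F ⟨(p.1 : 𝒢.Adelic) * p.2, mulMap_mem 𝒢 p⟩) (α.prod count) := by
  haveI : DiscreteTopology 𝒢.arithmeticSubgroup := hdisc
  haveI : BorelSpace 𝒢.arithmeticSubgroup := Subtype.borelSpace _
  haveI : MeasurableSingletonClass 𝒢.arithmeticSubgroup := inferInstance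
  haveI : (count : Measure 𝒢.arithmeticSubgroup).IsHaarMeasure := isHaarMeasure_count_of_discrete
  haveI : SecondCountableTopology 𝒢.center' := TopologicalSpace.Subtype.secondCountableTopology _
  haveI : SecondCountableTopology 𝒢.arithmeticSubgroup :=
    TopologicalSpace.Subtype.secondCountableTopology _
  haveI : BorelSpace (𝒢.center' × 𝒢.arithmeticSubgroup) := Prod.borelSpace
  set e := quotientSubgroupEquivOfRetraction 𝒢 θ hθA hθa hθγ hθc with he
  have hcomp : (fun p : 𝒢.center' × 𝒢.arithmeticSubgroup =>
      F ⟨(p.1 : 𝒢.Adelic) * p.2, mulMap_mem 𝒢 p⟩) = F ∘ e.symm := rfl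
  rw [hcomp]
  exact (hFc.comp e.symm.continuous).integrable_of_hasCompactSupport
    (hFs.comp_homeomorph e.symm.toHomeomorph)

end Product

/-- For `f ∈ C_c(G(𝔸_K))`, `x̃, ỹ ∈ G(𝔸_K)` and `H` closed, `h ↦ f(x̃ h⁻¹ ỹ⁻¹)` is continuous with
compact support on `H` (its support is the preimage of the compact `ỹ⁻¹ (supp f)⁻¹ x̃` under the
closed embedding `H ↪ G(𝔸_K)`). [folklore] -/
theorem hasCompactSupport_comp_conj {E : Type*} [NormedAddCommGroup E] [T2Space 𝒢.Adelic]
    (hH : IsClosed (𝒢.quotientSubgroup : Set 𝒢.Adelic))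
    {f : 𝒢.Adelic → E} (hfs : HasCompactSupport f) (x₀ y₀ : 𝒢.Adelic) :
    HasCompactSupport fun h : 𝒢.quotientSubgroup => f (x₀ * (h : 𝒢.Adelic)⁻¹ * y₀⁻¹) := by
  set A : Set 𝒢.Adelic := {y₀⁻¹} * (tsupport f)⁻¹ * {x₀} with hA
  have hAc : IsCompact A := (isCompact_singleton.mul hfs.isCompact.inv).mul isCompact_singleton
  refine HasCompactSupport.intro' (hH.isClosedEmbedding_subtypeVal.isCompact_preimage hAc)
    ((hAc.isClosed).preimage continuous_subtype_val) fun h hh => ?_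
  have hnot : x₀ * (h : 𝒢.Adelic)⁻¹ * y₀⁻¹ ∉ tsupport f := by
    intro hk
    apply hh
    change (h : 𝒢.Adelic) ∈ A
    refine ⟨y₀⁻¹ * (x₀ * (h : 𝒢.Adelic)⁻¹ * y₀⁻¹)⁻¹, ?_, x₀, rfl, by group⟩
    exact Set.mul_mem_mul rfl (Set.inv_mem_inv.2 hk)
  exact image_eq_zero_of_notMem_tsupport hnot

section Kernel

variable [LocallyCompactSpace 𝒢.Adelic] [SecondCountableTopology 𝒢.Adelic] [T2Space 𝒢.Adelic]
  [MeasurableSpace 𝒢.Adelic] [BorelSpace 𝒢.Adelic] [Countable 𝒢.arithmeticSubgroup]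
  [hH : IsClosed (𝒢.quotientSubgroup : Set 𝒢.Adelic)]
  (hdisc : 𝒢.IsDiscreteRational)
  (θ : 𝒢.Adelic →* 𝒢.Adelic) (hθc : Continuous θ) (hθA : ∀ g, θ g ∈ 𝒢.center')
  (hθa : ∀ a ∈ 𝒢.center', θ a = a) (hθγ : ∀ γ ∈ 𝒢.arithmeticSubgroup, θ γ = 1)
  (α : Measure 𝒢.center') [α.IsHaarMeasure] [SFinite α]
  (ρ : Measure 𝒢.quotientSubgroup) [ρ.IsMulLeftInvariant] [SFinite ρ] {κ : ℝ≥0}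
  (hκ : ρ = κ • Measure.map (fun p : 𝒢.center' × 𝒢.arithmeticSubgroup =>
      (⟨(p.1 : 𝒢.Adelic) * p.2, mulMap_mem 𝒢 p⟩ : 𝒢.quotientSubgroup)) (α.prod count))

include hdisc hθc hθA hθa hθγ hκ in
/-- **The kernel of `R(f)` as an integral over `A_G` of a sum over `G(K)`** (Gelbart (1975),
(9.20): `K(x, y) = Σ_{γ ∈ G_ℚ} f(x⁻¹ γ y)`; Bump (1997), proof of Prop. 2.3.1, with the integral
over `Z⁺` explicit). For an adelic group datum with a continuous central retraction, discrete
countable `G(K)`, `H = A_G · G(K)` closed, `ρ = κ • ((a, γ) ↦ a γ)_* (α ⊗ counting)` and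
`f ∈ C_c(G(𝔸_K))`:
`K_f(x̃, ỹH) = ∫_H f(x̃ h⁻¹ ỹ⁻¹) dρ(h) = κ • ∫_{A_G} Σ_{γ ∈ G(K)} f(x̃ γ⁻¹ a⁻¹ ỹ⁻¹) dα(a)`.
[cite: Gelbart1975, (9.7) and (9.20)] -/
theorem cosetKernel_mk_eq_smul_integral_tsum (f : C_c(𝒢.Adelic, ℂ)) (x₀ y₀ : 𝒢.Adelic) :
    cosetKernel 𝒢.quotientSubgroup ρ f x₀ (QuotientGroup.mk y₀) =
      κ • ∫ a, ∑' γ : 𝒢.arithmeticSubgroup,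
        f (x₀ * ((γ : 𝒢.Adelic)⁻¹ * (a : 𝒢.Adelic)⁻¹) * y₀⁻¹) ∂α := by
  have hf := f.continuous
  have hFc : Continuous fun h : 𝒢.quotientSubgroup => f (x₀ * (h : 𝒢.Adelic)⁻¹ * y₀⁻¹) := by
    fun_prop
  rw [cosetKernel_mk, integral_quotientSubgroup_eq_smul_integral_tsum 𝒢 θ hθc hθA hθa hθγ α
    hκ (integrable_comp_mul_of_continuous 𝒢 hdisc θ hθc hθA hθa hθγ α hFc
      (hasCompactSupport_comp_conj 𝒢 hH f.hasCompactSupport x₀ y₀))]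
  congr 1
  refine integral_congr_ae (Eventually.of_forall fun a => ?_)
  refine tsum_congr fun γ => ?_
  simp only [mul_inv_rev]

include hdisc hθc hθA hθa hθγ hκ in
/-- **The kernel on the diagonal** (Gelbart (1975), (9.12), Remark 9.23: the sum over the rational
points that the geometric side rearranges by conjugacy classes). With the hypotheses of
`cosetKernel_mk_eq_smul_integral_tsum` and `H` unimodular (`ρ` two-sided invariant,
`AdelicGroupDataQuotientUnimodular`): for `Φ ∈ C_c(G(𝔸_K))` and `x̃ ∈ G(𝔸_K)`,
`K_Φ(x̃H, x̃H) = κ • Σ_{γ ∈ G(K)} ∫_{A_G} Φ(a⁻¹ x̃ γ x̃⁻¹) dα(a)`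
(`A_G` central: `x̃ γ⁻¹ a⁻¹ x̃⁻¹ = a⁻¹ x̃ γ⁻¹ x̃⁻¹`; reindex `γ ↦ γ⁻¹`; exchange `Σ` and `∫` by
Fubini for `α ⊗ counting`). [cite: Gelbart1975, (9.12) and Remark 9.23] -/
theorem quotientKernel_mk_mk_eq_smul_tsum_integral [ρ.IsMulRightInvariant] (Φ : C_c(𝒢.Adelic, ℂ))
    (x₀ : 𝒢.Adelic) :
    quotientKernel 𝒢.quotientSubgroup ρ Φ (QuotientGroup.mk x₀) (QuotientGroup.mk x₀) =
      κ • ∑' γ : 𝒢.arithmeticSubgroup, ∫ a,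
        Φ ((a : 𝒢.Adelic)⁻¹ * (x₀ * (γ : 𝒢.Adelic) * x₀⁻¹)) ∂α := by
  -- the integrand on `H` and its integrability on `A_G × G(K)`
  have hΦ := Φ.continuous
  have hFc : Continuous fun h : 𝒢.quotientSubgroup => Φ (x₀ * (h : 𝒢.Adelic)⁻¹ * x₀⁻¹) := by
    fun_prop
  have hF := integrable_comp_mul_of_continuous 𝒢 hdisc θ hθc hθA hθa hθγ α hFc
    (hasCompactSupport_comp_conj 𝒢 hH Φ.hasCompactSupport x₀ x₀)
  rw [quotientKernel_mk_mk, integral_quotientSubgroup_eq_smul_tsum_integral 𝒢 θ hθc hθA hθa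
    hθγ α hκ hF]
  congr 1
  -- reindex `γ ↦ γ⁻¹` and use that `A_G` is central
  rw [← (Equiv.inv 𝒢.arithmeticSubgroup).tsum_eq]
  refine tsum_congr fun γ => ?_
  refine integral_congr_ae (Eventually.of_forall fun a => ?_)
  have hac : ((a : 𝒢.Adelic))⁻¹ ∈ Subgroup.center 𝒢.Adelic :=
    Subgroup.inv_mem _ (𝒢.center'_le a.2)
  simp only [Equiv.inv_apply, InvMemClass.coe_inv, mul_inv_rev, inv_inv]
  -- `x₀ * (γ * a⁻¹) * x₀⁻¹ = a⁻¹ * (x₀ * γ * x₀⁻¹)`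
  have h1 : (γ : 𝒢.Adelic) * ((a : 𝒢.Adelic))⁻¹ = ((a : 𝒢.Adelic))⁻¹ * γ :=
    Subgroup.mem_center_iff.1 hac γ
  have h2 : x₀ * ((a : 𝒢.Adelic))⁻¹ = ((a : 𝒢.Adelic))⁻¹ * x₀ := Subgroup.mem_center_iff.1 hac x₀
  congr 1
  calc x₀ * ((γ : 𝒢.Adelic) * ((a : 𝒢.Adelic))⁻¹) * x₀⁻¹
      = x₀ * (((a : 𝒢.Adelic))⁻¹ * γ) * x₀⁻¹ := by rw [h1]
    _ = x₀ * ((a : 𝒢.Adelic))⁻¹ * γ * x₀⁻¹ := by simp only [mul_assoc]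
    _ = ((a : 𝒢.Adelic))⁻¹ * x₀ * γ * x₀⁻¹ := by rw [h2]
    _ = ((a : 𝒢.Adelic))⁻¹ * (x₀ * γ * x₀⁻¹) := by simp only [mul_assoc]

end Kernel

end AdelicGroupData

end Literature.NumberTheory.Automorphic
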